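import Summits.Parity.GeneralizedHardyLittlewood.Theorems.LeeYangFibresRelativeDimOneSplitDefs
import HarnessLib

/-!
# The coset discrepancy: the error bracket is eventually small (crux stmt-Parity-14113
`LeeYangFibres.RelativeDimOne`, line gallagher-backwards-split, stub `stub_inversion`, PIECE 3f)

`coset_discrepancy_at` bounds `|Σ_{C*} bandSum (f − g)|` by `(q/φ(q))^t · P · Bracket` with

  `Bracket = 1/(W−1) + (q + ε₃ W)/(W−1) + t² 2^t (q/D) · W (log M)^t/(W−1)
             + ε₁ C₀ (2(1+ρ) + ε₄) + ε₁ N (1+ρ)/(W−1) + ε₄ + ε₂ (1+ρ) + ρ`,   `ρ = t 2^t q/D`.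

Here we show (`bracket_eventually_le`) that with `D = δN`, `M = L_M N + 2`, any window length `W` with
`2 ≤ W`, `δ_W N ≤ W − 1`, any modulus `1 ≤ q ≤ N^{θ₁}` (`θ₁ < 1`) and
`ε₁ ≤ η δ_W/(96 (C₀+1))`, `ε₂, ε₃ ≤ η/32`, `ε₄ ≤ η/16` (`δ, δ_W, η ≤ 1`), the bracket is `≤ η` for
`N ≥ N₀(t, θ₁, C₀, L_M, δ, δ_W, η)`; also `q ≤ δ N` and `ρ ≤ 1` then. Inputs: `N^{θ₁−1} → 0` and `(log N)^t = o(N^s)`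
(`isLittleO_log_rpow_rpow_atTop`).
-/

noncomputable section

open scoped BigOperators Classical Topology
open Finset Filter MeasureTheory Literature.NumberTheory.Sieve Asymptotics

namespace Summit.Parity.GeneralizedHardyLittlewood.Cruxes.RelativeDimOne.GallagherBackwardsSplit

/-! ### Two elementary limits along `ℕ` -/

/-- `N^{-s} ≤ c` for `N` large (`s, c > 0`). -/
theorem exists_nat_rpow_neg_le {s c : ℝ} (hs : 0 < s) (hc : 0 < c) :
    ∃ N₁ : ℕ, ∀ N : ℕ, N₁ ≤ N → (N : ℝ) ^ (-s) ≤ c := by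
  have h := ((tendsto_rpow_neg_atTop hs).comp tendsto_natCast_atTop_atTop).eventually
    (ge_mem_nhds hc)
  obtain ⟨N₁, hN₁⟩ := Filter.eventually_atTop.1 h
  exact ⟨N₁, fun N hN => hN₁ N hN⟩

/-- `(log N)^t ≤ N^s` for `N` large (`s > 0`). -/
theorem exists_nat_log_pow_le_rpow (t : ℕ) {s : ℝ} (hs : 0 < s) :
    ∃ N₂ : ℕ, ∀ N : ℕ, N₂ ≤ N → Real.log N ^ t ≤ (N : ℝ) ^ s := by
  have h := (isLittleO_log_rpow_rpow_atTop (t : ℝ) hs).def one_pos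
  have h' := tendsto_natCast_atTop_atTop.eventually h
  obtain ⟨N₂, hN₂⟩ := Filter.eventually_atTop.1 h'
  refine ⟨max N₂ 1, fun N hN => ?_⟩
  have hN2 : N₂ ≤ N := le_trans (le_max_left _ _) hN
  have hN1 : (1 : ℝ) ≤ N := by exact_mod_cast le_trans (le_max_right _ _) hN
  have := hN₂ N hN2
  rw [one_mul, Real.norm_eq_abs, Real.norm_eq_abs, Real.rpow_natCast,
    abs_of_nonneg (pow_nonneg (Real.log_nonneg hN1) t),
    abs_of_nonneg (Real.rpow_nonneg (by linarith) s)] at this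
  exact this

/-! ### The bracket at a fixed scale, from numeric smallness conditions -/

/-- If each of the eight terms is small, the bracket is `≤ η`. -/
theorem bracket_le_of_small {t : ℕ} {q W N D M C₀ ε₁ ε₂ ε₃ ε₄ η : ℝ}
    (hW2 : 2 ≤ W) (hW0 : 0 < W - 1)
    (h1 : 1 / (W - 1) ≤ η / 16) (h2 : q / (W - 1) ≤ η / 32) (h2' : ε₃ ≤ η / 32) (hε₃ : 0 ≤ ε₃)
    (h3 : t * t * 2 ^ t * (q / D) * (2 * Real.log M ^ t) ≤ η / 16) (hlog : 0 ≤ Real.log M)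
    (hqD0 : 0 ≤ q / D)
    (h4 : ε₁ * (C₀ + 1) * 6 ≤ η / 16) (hε₁ : 0 ≤ ε₁) (hC₀ : 0 ≤ C₀)
    (hρ1 : t * 2 ^ t * (q / D) ≤ 1) (hε₄1 : ε₄ ≤ 1)
    (h5 : ε₁ * N / (W - 1) ≤ η / 32) (hN : 0 ≤ N)
    (h6 : ε₄ ≤ η / 16) (h7 : ε₂ ≤ η / 32) (hε₂ : 0 ≤ ε₂) (h8 : t * 2 ^ t * (q / D) ≤ η / 16) :
    1 / (W - 1) + (q + ε₃ * W) / (W - 1)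
        + t * t * 2 ^ t * (q / D) * (W * Real.log M ^ t) / (W - 1)
        + ε₁ * C₀ * (2 * (1 + t * 2 ^ t * (q / D)) + ε₄)
        + ε₁ * N * (1 + t * 2 ^ t * (q / D)) / (W - 1)
        + ε₄ + ε₂ * (1 + t * 2 ^ t * (q / D)) + t * 2 ^ t * (q / D) ≤ η := by
  set ρ := (t : ℝ) * 2 ^ t * (q / D) with hρ
  have hρ0 : 0 ≤ ρ := by rw [hρ]; positivity
  have hWW : W / (W - 1) ≤ 2 := by
    rw [div_le_iff₀ hW0]; linarith
  -- T2
  have T2 : (q + ε₃ * W) / (W - 1) ≤ η / 32 + 2 * ε₃ := by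
    rw [add_div]
    have : ε₃ * W / (W - 1) = ε₃ * (W / (W - 1)) := by ring
    rw [this]
    nlinarith [mul_le_mul_of_nonneg_left hWW hε₃]
  -- T3
  have T3 : t * t * 2 ^ t * (q / D) * (W * Real.log M ^ t) / (W - 1) ≤ η / 16 := by
    have hlt : 0 ≤ Real.log M ^ t := pow_nonneg hlog t
    have hx : 0 ≤ (t : ℝ) * t * 2 ^ t * (q / D) := by positivity
    have : t * t * 2 ^ t * (q / D) * (W * Real.log M ^ t) / (W - 1) =
        t * t * 2 ^ t * (q / D) * Real.log M ^ t * (W / (W - 1)) := by ring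
    rw [this]
    calc (t : ℝ) * t * 2 ^ t * (q / D) * Real.log M ^ t * (W / (W - 1))
        ≤ t * t * 2 ^ t * (q / D) * Real.log M ^ t * 2 :=
          mul_le_mul_of_nonneg_left hWW (mul_nonneg hx hlt)
      _ = t * t * 2 ^ t * (q / D) * (2 * Real.log M ^ t) := by ring
      _ ≤ η / 16 := h3
  -- T4
  have T4 : ε₁ * C₀ * (2 * (1 + ρ) + ε₄) ≤ η / 16 := by
    have : 2 * (1 + ρ) + ε₄ ≤ 6 := by linarith
    calc ε₁ * C₀ * (2 * (1 + ρ) + ε₄) ≤ ε₁ * C₀ * 6 := by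
          apply mul_le_mul_of_nonneg_left this (mul_nonneg hε₁ hC₀)
      _ ≤ ε₁ * (C₀ + 1) * 6 := by nlinarith
      _ ≤ η / 16 := h4
  -- T5
  have T5 : ε₁ * N * (1 + ρ) / (W - 1) ≤ η / 16 := by
    have : ε₁ * N * (1 + ρ) / (W - 1) = ε₁ * N / (W - 1) * (1 + ρ) := by ring
    rw [this]
    have h0 : 0 ≤ ε₁ * N / (W - 1) := by positivity
    nlinarith
  -- T7
  have T7 : ε₂ * (1 + ρ) ≤ η / 16 := by nlinarith [mul_le_mul_of_nonneg_left hρ1 hε₂]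
  have hsum := add_le_add (add_le_add (add_le_add (add_le_add (add_le_add (add_le_add (add_le_add h1 T2) T3) T4) T5) h6) T7) h8
  linarith [hsum, h2']

/-! ### Eventual smallness -/

/-- `log (L_M N + 2) ≤ 2 log N` once `N ≥ L_M + 3`. -/
theorem log_height_le {LM : ℝ} (hLM : 0 ≤ LM) {N : ℝ} (hN : LM + 3 ≤ N) :
    Real.log (LM * N + 2) ≤ 2 * Real.log N := by
  have hN1 : 1 ≤ N := by linarith
  have hM : LM * N + 2 ≤ N ^ 2 := by nlinarith
  have hM0 : 0 < LM * N + 2 := by positivity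
  calc Real.log (LM * N + 2) ≤ Real.log (N ^ 2) := Real.log_le_log hM0 hM
    _ = 2 * Real.log N := by rw [Real.log_pow]; ring

/-- Algebra of the `ρ`-term: `t 2^t x ≤ η δ_W/64` when `x ≤ a/δ`, `a ≤ c = η δ δ_W/(64 T)`, `t 2^t ≤ T`. -/
theorem rho_term_bound {t : ℕ} {x a δ T η δW : ℝ} (hδ : 0 < δ) (hT : 0 < T) (hx : x ≤ a / δ)
    (ha : a ≤ η * δ * δW / (64 * T)) (htT : (t : ℝ) * 2 ^ t ≤ T) (hηδW : 0 ≤ η * δW) :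
    (t : ℝ) * 2 ^ t * x ≤ η * δW / 64 := by
  have h1 : x ≤ η * δW / (64 * T) := by
    refine le_trans hx ?_
    rw [div_le_iff₀ hδ]
    calc a ≤ η * δ * δW / (64 * T) := ha
      _ = η * δW / (64 * T) * δ := by field_simp
  have h0 : 0 ≤ η * δW / (64 * T) := by positivity
  calc (t : ℝ) * 2 ^ t * x ≤ T * (η * δW / (64 * T)) := by
        rcases le_or_gt 0 x with hx0 | hx0
        · exact mul_le_mul htT h1 hx0 hT.le
        · have : (t : ℝ) * 2 ^ t * x ≤ 0 :=
            mul_nonpos_of_nonneg_of_nonpos (by positivity) hx0.le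
          nlinarith [mul_nonneg hT.le h0]
    _ = η * δW / 64 := by field_simp

/-- Algebra of the logarithmic term: `t² 2^t x (2L) ≤ η/16` when `x ≤ a/δ`, `L ≤ 2^t b`,
`a b ≤ c = η δ δ_W/(64 T)` and `t² 4^t ≤ T`. -/
theorem log_term_bound {t : ℕ} {x a b L δ T η δW : ℝ} (hδ : 0 < δ) (hT : 0 < T)
    (hx : x ≤ a / δ) (ha : 0 ≤ a) (hb0 : 0 ≤ b) (hL0 : 0 ≤ L) (hL : L ≤ 2 ^ t * b)
    (hab : a * b ≤ η * δ * δW / (64 * T)) (httT : (t : ℝ) * t * 2 ^ t * 2 ^ t ≤ T) (hη : 0 < η)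
    (hδW1 : δW ≤ 1) :
    (t : ℝ) * t * 2 ^ t * x * (2 * L) ≤ η / 16 := by
  have h1 : (t : ℝ) * t * 2 ^ t * x * (2 * L) ≤ (t : ℝ) * t * 2 ^ t * (a / δ) * (2 * (2 ^ t * b)) := by
    apply mul_le_mul (mul_le_mul_of_nonneg_left hx (by positivity)) (by linarith) (by positivity)
      (by positivity)
  have h2 : (t : ℝ) * t * 2 ^ t * (a / δ) * (2 * (2 ^ t * b)) =
      2 * ((t : ℝ) * t * 2 ^ t * 2 ^ t) * (a * b) / δ := by
    field_simp
  have hab0 : 0 ≤ a * b := mul_nonneg ha hb0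
  have h3 : 2 * ((t : ℝ) * t * 2 ^ t * 2 ^ t) * (a * b) / δ ≤ 2 * T * (η * δ * δW / (64 * T)) / δ := by
    apply div_le_div_of_nonneg_right _ hδ.le
    apply mul_le_mul (by linarith) hab hab0 (by positivity)
  have h4 : 2 * T * (η * δ * δW / (64 * T)) / δ = η * δW / 32 := by
    field_simp
    ring
  have h5 : η * δW / 32 ≤ η / 16 := by
    rw [div_le_div_iff₀ (by norm_num) (by norm_num)]
    nlinarith [mul_le_mul_of_nonneg_left hδW1 hη.le]
  calc (t : ℝ) * t * 2 ^ t * x * (2 * L) ≤ (t : ℝ) * t * 2 ^ t * (a / δ) * (2 * (2 ^ t * b)) := h1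
    _ = 2 * ((t : ℝ) * t * 2 ^ t * 2 ^ t) * (a * b) / δ := h2
    _ ≤ 2 * T * (η * δ * δW / (64 * T)) / δ := h3
    _ = η * δW / 32 := h4
    _ ≤ η / 16 := h5

/-- THE BRACKET IS EVENTUALLY `≤ η` (see the file header; also `q ≤ δN` and `ρ ≤ 1`). -/
theorem bracket_eventually_le : ∀ (t : ℕ) (θ₁ C₀ LM δ δW η : ℝ), θ₁ < 1 → 0 ≤ C₀ → 0 ≤ LM → 0 < δ → δ ≤ 1 → 0 < δW → δW ≤ 1 → 0 < η → η ≤ 1 → ∃ N₀ : ℕ, ∀ N : ℕ, N₀ ≤ N → ∀ q : ℕ, 1 ≤ q → (q : ℝ) ≤ (N : ℝ) ^ θ₁ → ∀ W : ℕ, 2 ≤ W → δW * N ≤ (W : ℝ) - 1 → ∀ ε₁ ε₂ ε₃ ε₄ : ℝ, 0 ≤ ε₁ → ε₁ ≤ η * δW / (96 * (C₀ + 1)) → 0 ≤ ε₂ → ε₂ ≤ η / 32 → 0 ≤ ε₃ → ε₃ ≤ η / 32 → 0 ≤ ε₄ → ε₄ ≤ η / 16 → (q : ℝ) ≤ δ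 * N ∧ t * 2 ^ t * ((q : ℝ) / (δ * N)) ≤ 1 ∧ 1 / ((W : ℝ) - 1) + ((q : ℝ) + ε₃ * W) / ((W : ℝ) - 1) + t * t * 2 ^ t * ((q : ℝ) / (δ * N)) * (W * Real.log (LM * N + 2) ^ t) / ((W : ℝ) - 1) + ε₁ * C₀ * (2 * (1 + t * 2 ^ t * ((q : ℝ) / (δ * N))) + ε₄) + ε₁ * N * (1 + t * 2 ^ t * ((q : ℝ) / (δ * N))) / ((W : ℝ) - 1) + ε₄ + ε₂ * (1 + t * 2 ^ t * ((q : ℝ) / (δ * N))) + t * 2 ^ t * ((q : ℝ) / (δ * N)) ≤ η := by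
  intro t θ₁ C₀ LM δ δW η hθ₁ hC₀ hLM hδ hδ1 hδW hδW1 hη hη1
  set s : ℝ := (1 - θ₁) / 2 with hs
  have hs0 : 0 < s := by rw [hs]; linarith
  -- the constant `T = (t+1)² 4^t`
  set T : ℝ := ((t : ℝ) + 1) * ((t : ℝ) + 1) * (2 ^ t * 2 ^ t) with hT
  have ht0 : (0 : ℝ) ≤ t := Nat.cast_nonneg t
  have h2t0 : (0 : ℝ) < 2 ^ t := by positivity
  have h2t : (1 : ℝ) ≤ 2 ^ t := one_le_pow₀ (by norm_num)
  have hT0 : 0 < T := by rw [hT]; positivity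
  have hT1 : (1 : ℝ) ≤ T := by
    rw [hT]
    refine one_le_mul_of_one_le_of_one_le (one_le_mul_of_one_le_of_one_le ?_ ?_)
      (one_le_mul_of_one_le_of_one_le h2t h2t) <;> linarith
  have htT : (t : ℝ) * 2 ^ t ≤ T := by
    rw [hT]
    have h1 : (t : ℝ) ≤ ((t : ℝ) + 1) * ((t : ℝ) + 1) := by nlinarith only [ht0]
    have h2 : (2 : ℝ) ^ t ≤ 2 ^ t * 2 ^ t := le_mul_of_one_le_right h2t0.le h2t
    exact mul_le_mul h1 h2 h2t0.le (by positivity)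
  have httT : (t : ℝ) * t * 2 ^ t * 2 ^ t ≤ T := by
    rw [hT]
    have h1 : (t : ℝ) * t ≤ ((t : ℝ) + 1) * ((t : ℝ) + 1) := by nlinarith only [ht0]
    calc (t : ℝ) * t * 2 ^ t * 2 ^ t = (t * t) * (2 ^ t * 2 ^ t) := by ring
      _ ≤ ((t : ℝ) + 1) * ((t : ℝ) + 1) * (2 ^ t * 2 ^ t) :=
          mul_le_mul_of_nonneg_right h1 (by positivity)
  -- thresholds
  set c : ℝ := η * δ * δW / (64 * T) with hc
  have hc0 : 0 < c := by rw [hc]; positivity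
  obtain ⟨NA, hNA⟩ := exists_nat_rpow_neg_le (s := 2 * s) (by linarith) hc0
  obtain ⟨NB, hNB⟩ := exists_nat_rpow_neg_le hs0 hc0
  obtain ⟨NC, hNC⟩ := exists_nat_log_pow_le_rpow t hs0
  obtain ⟨ND, hND⟩ := exists_nat_ge (32 / (η * δW))
  obtain ⟨NE, hNE⟩ := exists_nat_ge (LM + 3)
  refine ⟨max (max (max NA NB) (max NC ND)) NE, ?_⟩
  intro N hN q hq hqN W hW2 hWδ ε₁ ε₂ ε₃ ε₄ hε₁0 hε₁ hε₂0 hε₂ hε₃0 hε₃ hε₄0 hε₄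
  have hNA' : NA ≤ N :=
    le_trans (le_trans (le_max_left _ _) (le_max_left _ _)) (le_trans (le_max_left _ _) hN)
  have hNB' : NB ≤ N :=
    le_trans (le_trans (le_max_right _ _) (le_max_left _ _)) (le_trans (le_max_left _ _) hN)
  have hNC' : NC ≤ N :=
    le_trans (le_trans (le_max_left _ _) (le_max_right _ _)) (le_trans (le_max_left _ _) hN)
  have hND' : ND ≤ N :=
    le_trans (le_trans (le_max_right _ _) (le_max_right _ _)) (le_trans (le_max_left _ _) hN)
  have hNE' : NE ≤ N := le_trans (le_max_right _ _) hN
  have hNr : (LM + 3 : ℝ) ≤ N := le_trans hNE (by exact_mod_cast hNE')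
  have hN0 : (0 : ℝ) < N := by linarith
  have hNDr : 32 / (η * δW) ≤ N := le_trans hND (by exact_mod_cast hND')
  have hWr : (2 : ℝ) ≤ W := by exact_mod_cast hW2
  have hW0 : 0 < (W : ℝ) - 1 := by linarith
  -- `a = N^{-2s}`, `b = N^s`
  have hpow : (N : ℝ) ^ (-(2 * s)) * N = (N : ℝ) ^ θ₁ := by
    rw [show -(2 * s) = θ₁ - 1 by rw [hs]; ring, Real.rpow_sub_one hN0.ne']
    field_simp
  have ha0 : 0 ≤ (N : ℝ) ^ (-(2 * s)) := Real.rpow_nonneg hN0.le _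
  have hqN' : (q : ℝ) / N ≤ (N : ℝ) ^ (-(2 * s)) := by
    rw [div_le_iff₀ hN0, hpow]; exact hqN
  have hA : (N : ℝ) ^ (-(2 * s)) ≤ c := hNA N hNA'
  have hx : (q : ℝ) / (δ * N) ≤ (N : ℝ) ^ (-(2 * s)) / δ := by
    rw [le_div_iff₀ hδ, div_mul_eq_mul_div, mul_comm, mul_div_mul_left _ _ hδ.ne']
    exact hqN'
  have hx0 : 0 ≤ (q : ℝ) / (δ * N) := by positivity
  have hab : (N : ℝ) ^ (-(2 * s)) * (N : ℝ) ^ s ≤ η * δ * δW / (64 * T) := by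
    rw [← Real.rpow_add hN0, show -(2 * s) + s = -s by ring]
    exact hNB N hNB'
  -- (i) q ≤ δ N
  have hcδ : c ≤ δ := by
    rw [hc, div_le_iff₀ (by positivity)]
    have h64 : (1 : ℝ) ≤ 64 * T := by linarith
    calc η * δ * δW ≤ 1 * δ * 1 := by
          apply mul_le_mul (mul_le_mul_of_nonneg_right hη1 hδ.le) hδW1 hδW.le (by positivity)
      _ = δ * 1 := by ring
      _ ≤ δ * (64 * T) := mul_le_mul_of_nonneg_left h64 hδ.le
  have hqδN : (q : ℝ) ≤ δ * N := by
    have h1 : (q : ℝ) / N ≤ δ := le_trans hqN' (le_trans hA hcδ)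
    rw [div_le_iff₀ hN0] at h1
    exact h1
  -- (ii) ρ ≤ η δW/64 ≤ 1, η/16
  have hρ : (t : ℝ) * 2 ^ t * ((q : ℝ) / (δ * N)) ≤ η * δW / 64 :=
    rho_term_bound hδ hT0 hx (by rw [← hc]; exact hA) htT (by positivity)
  have hηδW : η * δW ≤ 1 := mul_le_one₀ hη1 hδW.le hδW1
  have hηδWη : η * δW ≤ η := by
    have := mul_le_mul_of_nonneg_left hδW1 hη.le; linarith
  have hρ1 : (t : ℝ) * 2 ^ t * ((q : ℝ) / (δ * N)) ≤ 1 := by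
    refine le_trans hρ ?_
    rw [div_le_one (by norm_num)]; linarith
  have hρη : (t : ℝ) * 2 ^ t * ((q : ℝ) / (δ * N)) ≤ η / 16 := by
    refine le_trans hρ ?_
    rw [div_le_div_iff₀ (by norm_num) (by norm_num)]; linarith
  refine ⟨hqδN, hρ1, ?_⟩
  -- (1) 1/(W-1) ≤ η/16
  have h32 : 32 ≤ η * δW * N := by
    have := (div_le_iff₀ (mul_pos hη hδW)).1 hNDr; linarith
  have hηW : η * (δW * N) ≤ η * ((W : ℝ) - 1) := mul_le_mul_of_nonneg_left hWδ hη.le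
  have h1 : 1 / ((W : ℝ) - 1) ≤ η / 16 := by
    rw [div_le_div_iff₀ hW0 (by norm_num)]
    linarith
  -- (2) q/(W-1) ≤ η/32 : q ≤ c N ≤ (δW N) η/64 ≤ (W-1) η / 64
  have hqcN : (q : ℝ) ≤ c * N := by
    have := le_trans hqN' hA
    rwa [div_le_iff₀ hN0] at this
  have hc64 : c ≤ η * δW / 64 := by
    have e : c = η * δW / 64 * (δ / T) := by rw [hc]; field_simp
    rw [e]
    exact mul_le_of_le_one_right (by positivity) ((div_le_one hT0).2 (le_trans hδ1 hT1))
  have h2 : (q : ℝ) / ((W : ℝ) - 1) ≤ η / 32 := by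
    rw [div_le_div_iff₀ hW0 (by norm_num)]
    have : (q : ℝ) ≤ η * δW / 64 * N := le_trans hqcN (mul_le_mul_of_nonneg_right hc64 hN0.le)
    linarith
  -- (3) the log term
  have hM1 : (1 : ℝ) ≤ LM * N + 2 := by
    have := mul_nonneg hLM hN0.le; linarith
  have hL0 : 0 ≤ Real.log (LM * N + 2) ^ t := pow_nonneg (Real.log_nonneg hM1) t
  have hL : Real.log (LM * N + 2) ^ t ≤ 2 ^ t * (N : ℝ) ^ s := by
    calc Real.log (LM * N + 2) ^ t ≤ (2 * Real.log N) ^ t :=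
          pow_le_pow_left₀ (Real.log_nonneg hM1) (log_height_le hLM hNr) t
      _ = 2 ^ t * Real.log N ^ t := by rw [mul_pow]
      _ ≤ 2 ^ t * (N : ℝ) ^ s := mul_le_mul_of_nonneg_left (hNC N hNC') (by positivity)
  have h3 : (t : ℝ) * t * 2 ^ t * ((q : ℝ) / (δ * N)) * (2 * Real.log (LM * N + 2) ^ t) ≤ η / 16 :=
    log_term_bound hδ hT0 hx ha0 (Real.rpow_nonneg hN0.le s) hL0 hL hab httT hη hδW1
  -- (4) ε₁ (C₀+1) 6 ≤ η/16
  have hC1 : 0 < C₀ + 1 := by linarith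
  have e1 : ε₁ * (96 * (C₀ + 1)) ≤ η * δW := (le_div_iff₀ (by positivity)).1 hε₁
  have h4 : ε₁ * (C₀ + 1) * 6 ≤ η / 16 := by linarith
  -- (5) ε₁ N/(W-1) ≤ η/32
  have h5 : ε₁ * N / ((W : ℝ) - 1) ≤ η / 32 := by
    rw [div_le_div_iff₀ hW0 (by norm_num)]
    have e2 : ε₁ * 96 ≤ ε₁ * (96 * (C₀ + 1)) := by
      apply mul_le_mul_of_nonneg_left _ hε₁0; nlinarith only [hC₀]
    have e3 : ε₁ * 96 * N ≤ η * δW * N := mul_le_mul_of_nonneg_right (le_trans e2 e1) hN0.le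
    linarith
  have hε₄1 : ε₄ ≤ 1 := by linarith
  exact bracket_le_of_small hWr hW0 h1 h2 hε₃ hε₃0 h3 (Real.log_nonneg hM1) hx0 h4 hε₁0
    hC₀ hρ1 hε₄1 h5 (Nat.cast_nonneg N) hε₄ hε₂ hε₂0 hρη

end Summit.Parity.GeneralizedHardyLittlewood.Cruxes.RelativeDimOne.GallagherBackwardsSplit
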